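import Literature.NumberTheory.Automorphic.UnitaryThreeTorusBlockElementsTrace   -- ★ F1 (LH3-p02): trace-torus block `M(x,e,y)`, constructor, hom, readers, shape of `Z_H(t)`, norm-one coordinates, `|b| = |σb| = |bσb| = 1`
import Literature.NumberTheory.LocalFields.UnramifiedQuadraticNormOneUnitIndex    -- (r-d) ★ p-id pending (this seat): Hilbert 90 with a unit + `[G : S] = [Rˣ : U_j]` from `(hg : IsUnit (σR g − g))`
import Literature.NumberTheory.Automorphic.UnitaryThreeTorusDoubleCosetsHK          -- ★ `mem_unitaryInt_iff_forall_v_apply_le_one` (+ ★ Defs `flickerKH`, `mem_flickerKH_iff`)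
import HarnessLib

/-!
# Flicker's Proposition 6 (c) ∕ 7 in the TRACE FRAME, any residue characteristic: the weight `[Z_H(t) : Z_H(t) ∩ r_i K_H r_i⁻¹] = (q+1)q^{2i+ε−1}`
(Flicker (1998), *Elementary proof of the fundamental lemma for a unitary group*, Prop. 6 (c) p. 83, Prop. 7 p. 84)

Topic `NumberTheory/Automorphic`; namespace `Literature.NumberTheory.Automorphic.UnitaryGroup`.  THEOREMS ONLY (no definition, no instance, no notation, no named
fact, no `sorry`).  Cell `pub/hodgecm-mathlib`, LH4 price list LAYER B 3∕3 brick **F4** (dealer LH4-plan (g7) WORD #2: tokens T1–T6, riders (r-b)(r-c); CENSUS-LAYERB-3of3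
4277d501 (LH3-p02 (g6)) §1 row «★ `relIndex_flickerKH_conj_diagRadial_eq`» ∕ §2 (iii), CENSUS-R1 52a4c879 (LH4-p03), FINDING #6′).  Seat LH5-p01 (g5).  HONEST LABEL: HC_CM is
proved only modulo the printed citations (hLiu418 = stmt-HodgeConjecture-24832, h413 = stmt-HodgeConjecture-24833) until rung 0 closes; (D-UNR) stays PRINT by D74′; this file is a
count-neutral twin of ★ `UnitaryThreeTorusDoubleCosetsHKWeight` whose conclusion it reproduces TOKEN FOR TOKEN (T5), and the two LAYER-B COUNT heads stay hypotheses of their readers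
(§0.4 of the census: no `…CountsTrace.lean`).

MATHEMATICS.  `T = Z_H(t)` for the trace-frame regular torus block `t = M(x₁,x₂,x₃)`, `M(x,e,y) := !![x·σb + y·b, 0, π(x−y); 0, e, 0; π′·bσb·(x−y), 0, x·b + y·σb]`
(`b + σb = 1`, `ππ′ = 1`, `π = ϖ^ε`; ★ F1) consists of the blocks `M(x,e,y)` with NORM-ONE `x, e, y` (★ F1 `exists_coe_eq_traceTorusBlock_of_mem_centralizer`,
`map_mul_self_eq_one_of_coe_eq_traceTorusBlock`), read off the matrix by the INTEGRAL linear forms `x = τ₀₀ + b·π′·τ₀₂`, `y = τ₀₀ − σb·π′·τ₀₂` — no `½`.  Multiplication is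
coordinatewise (★ F1 `traceTorusBlock_mul`), so **`f : T →* Kˣ`, `τ ↦ x·σy` (`= x∕y`)** is a homomorphism with norm-one values reaching every `ι u ∕ σ(ι u)` (`x := ι u∕σ(ι u)`,
`y := 1`, ★ F1 constructor).  Conjugating by `r_i = diag(ϖ^{−i},1,ϖ^{i})` multiplies the `(0,2)` entry by `ϖ^{2i}` and the `(2,0)` entry by `ϖ^{−2i}`; with
`|x| = |y| = |e| = |b| = |σb| = 1` (★ F1 `v_eq_one_of_add_map_eq_one` — from `b + σb = 1` ALONE) and `|π′| = |ϖ|^{−ε}`: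
`τ ∈ r_i K_H r_i⁻¹ ⟺ |π′·bσb·(x−y)| ≤ |ϖ|^{2i} ⟺ |x − y| ≤ |ϖ|^{2i+ε} ⟺ |f τ − 1| ≤ |ϖ|^{2i+ε}` (**`f τ − 1 = (x − y)·σy`, NO factor `2`**).  Hence by the 2-free weight
transfer ★ (r-d) `TorusBridge.index_eq_index_units_of_normOne_of_isUnit_sub` (T1: `{gR} (hgR : IsUnit (σR gR − gR))`) and ★ (F3a) `index_comap_eqLocus_eq`∕`_zero`:
**`relIndex = [Rˣ : U_{2i+ε}] = if 2i+ε = 0 then 1 else (q+1)·q^{2i+ε−1}`** — Flicker's printed weight VERBATIM at every residue characteristic (census §0.1: for Flicker's own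
torus shape `(A, θ²C; C, A)` the weight would read `2i + ε + ord_E 2`; the trace torus is the one through the actual class).

* §1 `forall_v_radialConj_traceTorus_le_one_iff` — integrality of the `r_i`-conjugate of a trace block (the `(2,0)` entry decides).
* §2 `relIndex_flickerKH_conj_diagRadial_traceTorus_eq` — Prop. 6 (c)∕7 (conclusion = ★'s, token for token).

References: [Flicker1998UnitaryFL] Y. Z. Flicker, Canad. J. Math. 50 (1998), Prop. 6 (c) p. 83, Prop. 7 p. 84 · [Rogawski1990] J. D. Rogawski, Ann. of Math. Stud. 123, §4.9 p. 55. -/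

set_option autoImplicit false

open Matrix
open scoped MatrixGroups WithZero

namespace Literature.NumberTheory.Automorphic.UnitaryGroup

open IsLocalRing
open Literature.NumberTheory.Automorphic.HermitianLattice (unitaryInt UnramifiedLocalConjDatum)

section Weight

variable {K : Type*} [Field K] [Valued K ℤᵐ⁰] {ϖ : K} (σ : K →+* K) {J : Matrix (Fin 3) (Fin 3) K}
  (hJ : J = (StdForm.antidiagonal 3).over K) (hd : UnramifiedLocalConjDatum σ ϖ)

universe u

/-! ## §1 Integrality of the `r_i`-conjugate of a trace-torus block -/

/-- **Integrality of the `r_i`-conjugate of a trace-torus block**: for `N = !![x·sb + y·b, 0, ϖ^i·π(x−y)·ϖ^i; 0, e, 0; ϖ^{−i}·π′·b·sb·(x−y)·ϖ^{−i}, 0, x·b + y·sb]` with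
`|x|, |y|, |e|, |b|, |sb|, |π| ≤ 1`: all entries are integral iff `|π′·(b·sb·(x−y))| ≤ |ϖ^i|²` (only the `(2,0)` entry can fail). [cite: Flicker1998UnitaryFL, Prop. 6 (c) p. 83] -/
theorem forall_v_radialConj_traceTorus_le_one_iff {x y e b sb π π' ϖ : K} {i : ℕ} (hϖ0 : ϖ ≠ 0) (hvϖ : Valued.v ϖ ≤ 1) (hvx : Valued.v x ≤ 1)
    (hvy : Valued.v y ≤ 1) (hve : Valued.v e ≤ 1) (hvb : Valued.v b ≤ 1) (hvsb : Valued.v sb ≤ 1) (hvπ : Valued.v π ≤ 1) :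
    (∀ a d : Fin 3, Valued.v ((!![x * sb + y * b, 0, ϖ ^ i * (π * (x - y)) * ϖ ^ i; 0, e, 0; (ϖ ^ i)⁻¹ * (π' * (b * sb * (x - y))) * (ϖ ^ i)⁻¹, 0, x * b + y * sb] :
        Matrix (Fin 3) (Fin 3) K) a d) ≤ 1) ↔ Valued.v (π' * (b * sb * (x - y))) ≤ Valued.v (ϖ ^ i) * Valued.v (ϖ ^ i) := by
  have hϖi0 : ϖ ^ i ≠ 0 := pow_ne_zero _ hϖ0
  have hvi0 : Valued.v (ϖ ^ i * ϖ ^ i) ≠ 0 := (Valuation.ne_zero_iff _).2 (mul_ne_zero hϖi0 hϖi0)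
  have hvi1 : Valued.v (ϖ ^ i) ≤ 1 := by rw [map_pow]; exact pow_le_one₀ zero_le hvϖ
  set Q : K := π' * (b * sb * (x - y)) with hQ
  have e20 : (ϖ ^ i)⁻¹ * Q * (ϖ ^ i)⁻¹ = Q / (ϖ ^ i * ϖ ^ i) := by field_simp
  have key : Valued.v ((ϖ ^ i)⁻¹ * Q * (ϖ ^ i)⁻¹) ≤ 1 ↔ Valued.v Q ≤ Valued.v (ϖ ^ i) * Valued.v (ϖ ^ i) := by
    rw [e20, map_div₀, div_le_one₀ (zero_lt_iff.2 hvi0), Valuation.map_mul _ (ϖ ^ i) (ϖ ^ i)]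
  have hxy : Valued.v (x - y) ≤ 1 := Valuation.map_sub_le _ hvx hvy
  have h00 : Valued.v (x * sb + y * b) ≤ 1 :=
    Valuation.map_add_le _ (by rw [map_mul]; exact mul_le_one' hvx hvsb) (by rw [map_mul]; exact mul_le_one' hvy hvb)
  have h22 : Valued.v (x * b + y * sb) ≤ 1 :=
    Valuation.map_add_le _ (by rw [map_mul]; exact mul_le_one' hvx hvb) (by rw [map_mul]; exact mul_le_one' hvy hvsb)
  constructor
  · intro h
    exact key.1 (h 2 0)
  · intro hq a d
    have hvi1' : Valued.v ϖ ^ i ≤ 1 := pow_le_one₀ zero_le hvϖ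
    have h02 : Valued.v (ϖ ^ i * (π * (x - y)) * ϖ ^ i) ≤ 1 := by
      rw [map_mul, map_mul, map_mul, map_pow]
      exact mul_le_one' (mul_le_one' hvi1' (mul_le_one' hvπ hxy)) hvi1'
    have h20 : Valued.v ((ϖ ^ i)⁻¹ * Q * (ϖ ^ i)⁻¹) ≤ 1 := key.2 hq
    fin_cases a <;> fin_cases d <;> first | exact h00 | exact h22 | exact hve | exact h02 | exact h20 | simp

/-! ## §2 The weight (Prop. 6 (c) ∕ Prop. 7), trace frame, any residue characteristic -/

set_option maxHeartbeats 1600000 in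
-- one long explicit computation (the torus hom `τ ↦ x·σy`, its surjectivity and the integrality criterion) — the same budget as ★ `…HKWeight`
include hJ hd in
/-- **FLICKER'S PROPOSITION 6 (c) — THE WEIGHT `[Z_H(t) : Z_H(t) ∩ r_i K_H r_i⁻¹] = [R_E^× : R_E(2i+ε)^×] = (q+1)·q^{2i+ε−1}`** (and `= 1` when `2i+ε = 0`), TRACE FRAME, any
residue characteristic — ★ `relIndex_flickerKH_conj_diagRadial_eq` with: T2 `(hd : UnramifiedLocalConjDatum σ ϖ)` + `(h2 : (2 : K) ≠ 0)` (characteristic token, for the block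
shape only) in place of `LocalConjDatum`; T1 `{gR} (hgR : IsUnit (σR gR − gR))` in place of `(hdRσ) (hdRu) (h2R)`; T3 the trace literal `t = M(x₁,x₂,x₃)` with `(hπε) (hππ) (hb)
(hbv) (hx : x₁ ≠ x₃)` in place of `(hθε) (hθ) (hte) (hC) (hBC)`; T4∕T5 objects `r i`, `c`, `flickerKH` and the CONCLUSION unchanged (so ★ (F3a) and every LAYER-C consumer re-dock by
name).  PROOF: `f : τ ↦ x·σy` (★ F1 shape∕hom∕readers), `f τ − 1 = (x − y)·σy`, `τ ∈ r_iK_Hr_i⁻¹ ⟺ |x − y| ≤ |ϖ|^{2i+ε}` (§1, `|π′| = |ϖ|^{−ε}`, `|bσb| = 1`), then ★ (r-d)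
`index_eq_index_units_of_normOne_of_isUnit_sub` and ★ (F3a).  Bottom row of record: CENSUS-LAYERB-3of3 4277d501 row F4 (LH3-p02); the COUNT heads stay hypotheses (census §0.4).
[cite: Flicker1998UnitaryFL, Prop. 6 (c) p. 83, Prop. 7 p. 84] -/
theorem relIndex_flickerKH_conj_diagRadial_traceTorus_eq (h2 : (2 : K) ≠ 0)
    {R : Type u} [CommRing R] [IsDomain R] [IsDiscreteValuationRing R] [Finite (ResidueField R)] (ι : R →+* K) (hι : Function.Injective ι)
    (hιv : ∀ x : K, Valued.v x ≤ 1 ↔ x ∈ Set.range ι) (σR : R →+* R) (hσR : ∀ r, σR (σR r) = r) (hσι : ∀ r, ι (σR r) = σ (ι r))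
    {gR : R} (hgR : IsUnit (σR gR - gR)) {ϖR : R} (hϖR : Irreducible ϖR) (hιϖ : ι ϖR = ϖ)
    {q₀ : ℕ} (hq : Nat.card (ResidueField R) = q₀ ^ 2)
    {c : ↥(unitaryGroupOfForm σ J)} (hc : ((c : GL (Fin 3) K) : Matrix (Fin 3) (Fin 3) K) = !![1, 0, 0; 0, -1, 0; 0, 0, 1])
    {π π' : K} {ε : ℕ} (hπε : π = ϖ ^ ε) (hππ : π * π' = 1) {b : K} (hb : b + σ b = 1) (hbv : Valued.v b ≤ 1)
    {t : ↥(unitaryGroupOfForm σ J)} (htH : t ∈ Subgroup.centralizer ({c} : Set ↥(unitaryGroupOfForm σ J))) {x₁ x₂ x₃ : K}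
    (hte : ((t : GL (Fin 3) K) : Matrix (Fin 3) (Fin 3) K) =
      !![x₁ * σ b + x₃ * b, 0, π * (x₁ - x₃); 0, x₂, 0; π' * (b * σ b * (x₁ - x₃)), 0, x₁ * b + x₃ * σ b]) (hx : x₁ ≠ x₃)
    (r : ℕ → ↥(Subgroup.centralizer ({c} : Set ↥(unitaryGroupOfForm σ J))))
    (hr : ∀ i, (((r i : ↥(unitaryGroupOfForm σ J)) : GL (Fin 3) K) : Matrix (Fin 3) (Fin 3) K) = !![(ϖ ^ i)⁻¹, 0, 0; 0, 1, 0; 0, 0, ϖ ^ i])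
    (i : ℕ) :
    ((((flickerKH σ J c).subgroupOf (Subgroup.centralizer ({c} : Set ↥(unitaryGroupOfForm σ J)))).map (MulAut.conj (r i)).toMonoidHom).relIndex
        (Subgroup.centralizer ({⟨t, htH⟩} : Set ↥(Subgroup.centralizer ({c} : Set ↥(unitaryGroupOfForm σ J)))))) =
      if 2 * i + ε = 0 then 1 else (q₀ + 1) * q₀ ^ (2 * i + ε - 1) := by
  classical
  -- scalar facts
  have hσσ : ∀ z, σ (σ z) = z := hd.σσ
  have hσv : ∀ z, Valued.v (σ z) = Valued.v z := hd.vσ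
  have hσϖ : σ ϖ = ϖ := hd.σϖ
  have hϖ0 : ϖ ≠ 0 := fun h0 => by have := hd.vϖ; rw [h0, map_zero] at this; exact WithZero.zero_ne_coe this
  have hπ0 : π ≠ 0 := by rw [hπε]; exact pow_ne_zero _ hϖ0
  have hσπ : σ π = π := by rw [hπε, map_pow, hσϖ]
  have hπ'e : π' = π⁻¹ := (inv_eq_of_mul_eq_one_right hππ).symm
  have hσπ' : σ π' = π' := by rw [hπ'e, map_inv₀, hσπ]
  obtain ⟨hvb, hvσb, hvbσb⟩ := v_eq_one_of_add_map_eq_one σ hσv hbv hb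
  have hvϖ1 : Valued.v ϖ ≤ 1 := by rw [hd.vϖ, ← WithZero.exp_zero, WithZero.exp_le_exp]; simp
  have hvπ : Valued.v π = Valued.v (ϖ ^ ε) := by rw [hπε]
  have hvπ1 : Valued.v π ≤ 1 := by rw [hvπ, map_pow]; exact pow_le_one₀ zero_le hvϖ1
  have hvπ0 : Valued.v π ≠ 0 := (Valuation.ne_zero_iff _).2 hπ0
  have hvπ' : Valued.v π' = (Valued.v π)⁻¹ := by rw [hπ'e, map_inv₀]
  -- (1) the shape of `τ ∈ T = Z_H(t)` (★ F1): `↑τ = M(x,e,y)` with the READ coordinates `x = τ₀₀ + bπ′τ₀₂`, `y = τ₀₀ − σb·π′τ₀₂`, `e = τ₁₁`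
  have hshape : ∀ τ : ↥(Subgroup.centralizer ({⟨t, htH⟩} : Set ↥(Subgroup.centralizer ({c} : Set ↥(unitaryGroupOfForm σ J))))), ∃ x e y : K, ((((τ : ↥(Subgroup.centralizer ({c} : Set ↥(unitaryGroupOfForm σ J)))) : ↥(unitaryGroupOfForm σ J)) : GL (Fin 3) K) : Matrix (Fin 3) (Fin 3) K) = !![x * σ b + y * b, 0, π * (x - y); 0, e, 0; π' * (b * σ b * (x - y)), 0, x * b + y * σ b] ∧
      x = (((((τ : ↥(Subgroup.centralizer ({c} : Set ↥(unitaryGroupOfForm σ J)))) : ↥(unitaryGroupOfForm σ J)) : GL (Fin 3) K) : Matrix (Fin 3) (Fin 3) K) 0 0 + b * π' * ((((τ : ↥(Subgroup.centralizer ({c} : Set ↥(unitaryGroupOfForm σ J)))) : ↥(unitaryGroupOfForm σ J)) : GL (Fin 3) K) : Matrix (Fin 3) (Fin 3) K) 0 2) ∧ y = (((((τ : ↥(Subgroup.centralizer ({c} : Set ↥(unitaryGroupOfForm σ J)))) : ↥(unitaryGroupOfForm σ J)) : GL (Fin 3) K) : Matrix (Fin 3) (Fin 3) K) 0 0 - σ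 b * π' * ((((τ : ↥(Subgroup.centralizer ({c} : Set ↥(unitaryGroupOfForm σ J)))) : ↥(unitaryGroupOfForm σ J)) : GL (Fin 3) K) : Matrix (Fin 3) (Fin 3) K) 0 2) ∧ e = ((((τ : ↥(Subgroup.centralizer ({c} : Set ↥(unitaryGroupOfForm σ J)))) : ↥(unitaryGroupOfForm σ J)) : GL (Fin 3) K) : Matrix (Fin 3) (Fin 3) K) 1 1 := by
    intro τ
    have hτt : ((τ : ↥(Subgroup.centralizer ({c} : Set ↥(unitaryGroupOfForm σ J)))) : ↥(unitaryGroupOfForm σ J)) ∈ Subgroup.centralizer ({t} : Set ↥(unitaryGroupOfForm σ J)) := by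
      rw [Subgroup.mem_centralizer_singleton_iff]
      exact congrArg Subtype.val (Subgroup.mem_centralizer_singleton_iff.1 τ.2)
    exact exists_coe_eq_traceTorusBlock_of_mem_centralizer σ h2 hc hb hππ hx hte (τ : ↥(Subgroup.centralizer ({c} : Set ↥(unitaryGroupOfForm σ J)))).2 hτt
  -- (2) the read coordinates are norm-one
  have hcoord : ∀ τ : ↥(Subgroup.centralizer ({⟨t, htH⟩} : Set ↥(Subgroup.centralizer ({c} : Set ↥(unitaryGroupOfForm σ J))))), σ (((((τ : ↥(Subgroup.centralizer ({c} : Set ↥(unitaryGroupOfForm σ J)))) : ↥(unitaryGroupOfForm σ J)) : GL (Fin 3) K) : Matrix (Fin 3) (Fin 3) K) 0 0 + b * π' * ((((τ : ↥(Subgroup.centralizer ({c} : Set ↥(unitaryGroupOfForm σ J)))) : ↥(unitaryGroupOfForm σ J)) : GL (Fin 3) K) : Matrix (Fin 3) (Fin 3) K) 0 2) * (((((τ : ↥(Subgroup.centralizer ({c} : Set ↥(unitaryGroupOfForm σ J)))) : ↥(unitaryGroupOfForm σ J)) : GL (Fin 3) K) : Matrix (Fin 3) (Fin 3) K) 0 0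 + b * π' * ((((τ : ↥(Subgroup.centralizer ({c} : Set ↥(unitaryGroupOfForm σ J)))) : ↥(unitaryGroupOfForm σ J)) : GL (Fin 3) K) : Matrix (Fin 3) (Fin 3) K) 0 2) = 1 ∧ σ (((((τ : ↥(Subgroup.centralizer ({c} : Set ↥(unitaryGroupOfForm σ J)))) : ↥(unitaryGroupOfForm σ J)) : GL (Fin 3) K) : Matrix (Fin 3) (Fin 3) K) 1 1) * ((((τ : ↥(Subgroup.centralizer ({c} : Set ↥(unitaryGroupOfForm σ J)))) : ↥(unitaryGroupOfForm σ J)) : GL (Fin 3) K) : Matrix (Fin 3) (Fin 3) K) 1 1 = 1 ∧ σ (((((τ : ↥(Subgroup.centralizer ({c} : Set ↥(unitaryGroupOfForm σ J)))) : ↥(unitaryGroupOfForm σ J)) : GL (Fin 3) K) : Matrix (Fin 3) (Fin 3) K) 0 0 - σ b * π' * ((((τ : ↥(Subgroup.centralizer ({c} : Set ↥(unitaryGroupOfForm σ J)))) : ↥(unitaryGroupOfForm σ J)) : GL (Fin 3) K) : Matrix (Fin 3) (Fin 3) K) 0 2) * (((((τ : ↥(Subgroup.centralizer ({c} : Set ↥(unitaryGroupOfForm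 σ J)))) : ↥(unitaryGroupOfForm σ J)) : GL (Fin 3) K) : Matrix (Fin 3) (Fin 3) K) 0 0 - σ b * π' * ((((τ : ↥(Subgroup.centralizer ({c} : Set ↥(unitaryGroupOfForm σ J)))) : ↥(unitaryGroupOfForm σ J)) : GL (Fin 3) K) : Matrix (Fin 3) (Fin 3) K) 0 2) = 1 := by
    intro τ
    obtain ⟨x, e, y, hM, hxr, hyr, her⟩ := hshape τ
    have h := map_mul_self_eq_one_of_coe_eq_traceTorusBlock σ hJ hσσ hb hππ hσπ hσπ' hM
    rw [hxr, hyr, her] at h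
    exact h
  have hne : ∀ τ : ↥(Subgroup.centralizer ({⟨t, htH⟩} : Set ↥(Subgroup.centralizer ({c} : Set ↥(unitaryGroupOfForm σ J))))), (((((τ : ↥(Subgroup.centralizer ({c} : Set ↥(unitaryGroupOfForm σ J)))) : ↥(unitaryGroupOfForm σ J)) : GL (Fin 3) K) : Matrix (Fin 3) (Fin 3) K) 0 0 + b * π' * ((((τ : ↥(Subgroup.centralizer ({c} : Set ↥(unitaryGroupOfForm σ J)))) : ↥(unitaryGroupOfForm σ J)) : GL (Fin 3) K) : Matrix (Fin 3) (Fin 3) K) 0 2) ≠ 0 ∧ (((((τ : ↥(Subgroup.centralizer ({c} : Set ↥(unitaryGroupOfForm σ J)))) : ↥(unitaryGroupOfForm σ J)) : GL (Fin 3) K) : Matrix (Fin 3) (Fin 3) K) 0 0 - σ b * π' * ((((τ : ↥(Subgroup.centralizer ({c} : Set ↥(unitaryGroupOfForm σ J)))) : ↥(unitaryGroupOfForm σ J)) : GL (Fin 3) K) : Matrix (Fin 3) (Fin 3) K) 0 2) ≠ 0 := by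
    intro τ
    obtain ⟨h1, -, h3⟩ := hcoord τ
    exact ⟨fun h0 => by rw [h0, mul_zero] at h1; exact zero_ne_one h1, fun h0 => by rw [h0, mul_zero] at h3; exact zero_ne_one h3⟩
  -- (3) the homomorphism `f : T → Kˣ`, `τ ↦ x·σy`
  let F : ↥(Subgroup.centralizer ({⟨t, htH⟩} : Set ↥(Subgroup.centralizer ({c} : Set ↥(unitaryGroupOfForm σ J))))) → Kˣ := fun τ =>
    Units.mk0 ((((((τ : ↥(Subgroup.centralizer ({c} : Set ↥(unitaryGroupOfForm σ J)))) : ↥(unitaryGroupOfForm σ J)) : GL (Fin 3) K) : Matrix (Fin 3) (Fin 3) K) 0 0 + b * π' * ((((τ : ↥(Subgroup.centralizer ({c} : Set ↥(unitaryGroupOfForm σ J)))) : ↥(unitaryGroupOfForm σ J)) : GL (Fin 3) K) : Matrix (Fin 3) (Fin 3) K) 0 2) * σ (((((τ : ↥(Subgroup.centralizer ({c} : Set ↥(unitaryGroupOfForm σ J)))) : ↥(unitaryGroupOfForm σ J)) : GL (Fin 3) K) : Matrix (Fin 3) (Fin 3) K) 0 0 - σ b * π' * ((((τ : ↥(Subgroup.centralizer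 ({c} : Set ↥(unitaryGroupOfForm σ J)))) : ↥(unitaryGroupOfForm σ J)) : GL (Fin 3) K) : Matrix (Fin 3) (Fin 3) K) 0 2)) (mul_ne_zero (hne τ).1 ((map_ne_zero σ).2 (hne τ).2))
  have hFv : ∀ τ : ↥(Subgroup.centralizer ({⟨t, htH⟩} : Set ↥(Subgroup.centralizer ({c} : Set ↥(unitaryGroupOfForm σ J))))), ((F τ : Kˣ) : K) = (((((τ : ↥(Subgroup.centralizer ({c} : Set ↥(unitaryGroupOfForm σ J)))) : ↥(unitaryGroupOfForm σ J)) : GL (Fin 3) K) : Matrix (Fin 3) (Fin 3) K) 0 0 + b * π' * ((((τ : ↥(Subgroup.centralizer ({c} : Set ↥(unitaryGroupOfForm σ J)))) : ↥(unitaryGroupOfForm σ J)) : GL (Fin 3) K) : Matrix (Fin 3) (Fin 3) K) 0 2) * σ (((((τ : ↥(Subgroup.centralizer ({c} : Set ↥(unitaryGroupOfForm σ J)))) : ↥(unitaryGroupOfForm σ J)) : GL (Fin 3) K) : Matrix (Fin 3) (Fin 3) K) 0 0 - σ b * π' * ((((τ : ↥(Subgroup.centralizer ({c} : Set ↥(unitaryGroupOfForm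 σ J)))) : ↥(unitaryGroupOfForm σ J)) : GL (Fin 3) K) : Matrix (Fin 3) (Fin 3) K) 0 2) := fun τ => rfl
  have hmul : ∀ τ₁ τ₂ : ↥(Subgroup.centralizer ({⟨t, htH⟩} : Set ↥(Subgroup.centralizer ({c} : Set ↥(unitaryGroupOfForm σ J))))), F (τ₁ * τ₂) = F τ₁ * F τ₂ := by
    intro τ₁ τ₂
    apply Units.ext
    rw [Units.val_mul, hFv, hFv, hFv]
    obtain ⟨x, e, y, h₁, hx1, hy1, -⟩ := hshape τ₁
    obtain ⟨x', e', y', h₂, hx2, hy2, -⟩ := hshape τ₂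
    have hm : (((((τ₁ * τ₂ : ↥(Subgroup.centralizer ({⟨t, htH⟩} : Set ↥(Subgroup.centralizer ({c} : Set ↥(unitaryGroupOfForm σ J)))))) : ↥(Subgroup.centralizer ({c} : Set ↥(unitaryGroupOfForm σ J)))) : ↥(unitaryGroupOfForm σ J)) : GL (Fin 3) K) : Matrix (Fin 3) (Fin 3) K) = ((((τ₁ : ↥(Subgroup.centralizer ({c} : Set ↥(unitaryGroupOfForm σ J)))) : ↥(unitaryGroupOfForm σ J)) : GL (Fin 3) K) : Matrix (Fin 3) (Fin 3) K) * ((((τ₂ : ↥(Subgroup.centralizer ({c} : Set ↥(unitaryGroupOfForm σ J)))) : ↥(unitaryGroupOfForm σ J)) : GL (Fin 3) K) : Matrix (Fin 3) (Fin 3) K) := by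
      simp only [Subgroup.coe_mul, Units.val_mul]
    have hprod : (((((τ₁ * τ₂ : ↥(Subgroup.centralizer ({⟨t, htH⟩} : Set ↥(Subgroup.centralizer ({c} : Set ↥(unitaryGroupOfForm σ J)))))) : ↥(Subgroup.centralizer ({c} : Set ↥(unitaryGroupOfForm σ J)))) : ↥(unitaryGroupOfForm σ J)) : GL (Fin 3) K) : Matrix (Fin 3) (Fin 3) K) = !![(x * x') * σ b + (y * y') * b, 0, π * ((x * x') - (y * y')); 0, (e * e'), 0; π' * (b * σ b * ((x * x') - (y * y'))), 0, (x * x') * b + (y * y') * σ b] := by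
      rw [hm, h₁, h₂, traceTorusBlock_mul σ hb hππ]
    have hX : ((((((τ₁ * τ₂ : ↥(Subgroup.centralizer ({⟨t, htH⟩} : Set ↥(Subgroup.centralizer ({c} : Set ↥(unitaryGroupOfForm σ J)))))) : ↥(Subgroup.centralizer ({c} : Set ↥(unitaryGroupOfForm σ J)))) : ↥(unitaryGroupOfForm σ J)) : GL (Fin 3) K) : Matrix (Fin 3) (Fin 3) K) 0 0 + b * π' * (((((τ₁ * τ₂ : ↥(Subgroup.centralizer ({⟨t, htH⟩} : Set ↥(Subgroup.centralizer ({c} : Set ↥(unitaryGroupOfForm σ J)))))) : ↥(Subgroup.centralizer ({c} : Set ↥(unitaryGroupOfForm σ J)))) : ↥(unitaryGroupOfForm σ J)) : GL (Fin 3) K) : Matrix (Fin 3) (Fin 3) K) 0 2) = x * x' := by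
      rw [hprod]; simp only [Matrix.of_apply, Matrix.cons_val', Matrix.cons_val_zero, Matrix.cons_val_two, Matrix.empty_val', Matrix.cons_val_fin_one,
        Matrix.tail_cons, Matrix.head_cons]
      linear_combination traceTorusBlock_read_fst σ hb hππ (x * x') (y * y')
    have hY : ((((((τ₁ * τ₂ : ↥(Subgroup.centralizer ({⟨t, htH⟩} : Set ↥(Subgroup.centralizer ({c} : Set ↥(unitaryGroupOfForm σ J)))))) : ↥(Subgroup.centralizer ({c} : Set ↥(unitaryGroupOfForm σ J)))) : ↥(unitaryGroupOfForm σ J)) : GL (Fin 3) K) : Matrix (Fin 3) (Fin 3) K) 0 0 - σ b * π' * (((((τ₁ * τ₂ : ↥(Subgroup.centralizer ({⟨t, htH⟩} : Set ↥(Subgroup.centralizer ({c} : Set ↥(unitaryGroupOfForm σ J)))))) : ↥(Subgroup.centralizer ({c} : Set ↥(unitaryGroupOfForm σ J)))) : ↥(unitaryGroupOfForm σ J)) : GL (Fin 3) K) : Matrix (Fin 3) (Fin 3) K) 0 2) = y * y' := by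
      rw [hprod]; simp only [Matrix.of_apply, Matrix.cons_val', Matrix.cons_val_zero, Matrix.cons_val_two, Matrix.empty_val', Matrix.cons_val_fin_one,
        Matrix.tail_cons, Matrix.head_cons]
      linear_combination traceTorusBlock_read_snd σ hb hππ (x * x') (y * y')
    rw [hX, hY, ← hx1, ← hy1, ← hx2, ← hy2, map_mul]
    ring
  let f : ↥(Subgroup.centralizer ({⟨t, htH⟩} : Set ↥(Subgroup.centralizer ({c} : Set ↥(unitaryGroupOfForm σ J))))) →* Kˣ := MonoidHom.mk' F hmul
  have hfv : ∀ τ : ↥(Subgroup.centralizer ({⟨t, htH⟩} : Set ↥(Subgroup.centralizer ({c} : Set ↥(unitaryGroupOfForm σ J))))), ((f τ : Kˣ) : K) = (((((τ : ↥(Subgroup.centralizer ({c} : Set ↥(unitaryGroupOfForm σ J)))) : ↥(unitaryGroupOfForm σ J)) : GL (Fin 3) K) : Matrix (Fin 3) (Fin 3) K) 0 0 + b * π' * ((((τ : ↥(Subgroup.centralizer ({c} : Set ↥(unitaryGroupOfForm σ J)))) : ↥(unitaryGroupOfForm σ J)) : GL (Fin 3) K) : Matrix (Fin 3) (Fin 3)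 K) 0 2) * σ (((((τ : ↥(Subgroup.centralizer ({c} : Set ↥(unitaryGroupOfForm σ J)))) : ↥(unitaryGroupOfForm σ J)) : GL (Fin 3) K) : Matrix (Fin 3) (Fin 3) K) 0 0 - σ b * π' * ((((τ : ↥(Subgroup.centralizer ({c} : Set ↥(unitaryGroupOfForm σ J)))) : ↥(unitaryGroupOfForm σ J)) : GL (Fin 3) K) : Matrix (Fin 3) (Fin 3) K) 0 2) := fun τ => rfl
  -- norm-one values
  have hf : ∀ τ : ↥(Subgroup.centralizer ({⟨t, htH⟩} : Set ↥(Subgroup.centralizer ({c} : Set ↥(unitaryGroupOfForm σ J))))), ((f τ : Kˣ) : K) * σ ((f τ : Kˣ) : K) = 1 := by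
    intro τ
    obtain ⟨h1, -, h3⟩ := hcoord τ
    rw [hfv, map_mul, hσσ]
    calc (((((τ : ↥(Subgroup.centralizer ({c} : Set ↥(unitaryGroupOfForm σ J)))) : ↥(unitaryGroupOfForm σ J)) : GL (Fin 3) K) : Matrix (Fin 3) (Fin 3) K) 0 0 + b * π' * ((((τ : ↥(Subgroup.centralizer ({c} : Set ↥(unitaryGroupOfForm σ J)))) : ↥(unitaryGroupOfForm σ J)) : GL (Fin 3) K) : Matrix (Fin 3) (Fin 3) K) 0 2) * σ (((((τ : ↥(Subgroup.centralizer ({c} : Set ↥(unitaryGroupOfForm σ J)))) : ↥(unitaryGroupOfForm σ J)) : GL (Fin 3) K) : Matrix (Fin 3) (Fin 3) K) 0 0 - σ b * π' * ((((τ : ↥(Subgroup.centralizer ({c} : Set ↥(unitaryGroupOfForm σ J)))) : ↥(unitaryGroupOfForm σ J)) : GL (Fin 3) K) : Matrix (Fin 3) (Fin 3) K) 0 2) * (σ (((((τ : ↥(Subgroup.centralizer ({c} : Set ↥(unitaryGroupOfForm σ J)))) : ↥(unitaryGroupOfForm σ J)) : GL (Fin 3) K) : Matrix (Fin 3) (Fin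 3) K) 0 0 + b * π' * ((((τ : ↥(Subgroup.centralizer ({c} : Set ↥(unitaryGroupOfForm σ J)))) : ↥(unitaryGroupOfForm σ J)) : GL (Fin 3) K) : Matrix (Fin 3) (Fin 3) K) 0 2) * (((((τ : ↥(Subgroup.centralizer ({c} : Set ↥(unitaryGroupOfForm σ J)))) : ↥(unitaryGroupOfForm σ J)) : GL (Fin 3) K) : Matrix (Fin 3) (Fin 3) K) 0 0 - σ b * π' * ((((τ : ↥(Subgroup.centralizer ({c} : Set ↥(unitaryGroupOfForm σ J)))) : ↥(unitaryGroupOfForm σ J)) : GL (Fin 3) K) : Matrix (Fin 3) (Fin 3) K) 0 2))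
        = (σ (((((τ : ↥(Subgroup.centralizer ({c} : Set ↥(unitaryGroupOfForm σ J)))) : ↥(unitaryGroupOfForm σ J)) : GL (Fin 3) K) : Matrix (Fin 3) (Fin 3) K) 0 0 + b * π' * ((((τ : ↥(Subgroup.centralizer ({c} : Set ↥(unitaryGroupOfForm σ J)))) : ↥(unitaryGroupOfForm σ J)) : GL (Fin 3) K) : Matrix (Fin 3) (Fin 3) K) 0 2) * (((((τ : ↥(Subgroup.centralizer ({c} : Set ↥(unitaryGroupOfForm σ J)))) : ↥(unitaryGroupOfForm σ J)) : GL (Fin 3) K) : Matrix (Fin 3) (Fin 3) K) 0 0 + b * π' * ((((τ : ↥(Subgroup.centralizer ({c} : Set ↥(unitaryGroupOfForm σ J)))) : ↥(unitaryGroupOfForm σ J)) : GL (Fin 3) K) : Matrix (Fin 3) (Fin 3) K) 0 2)) * (σ (((((τ : ↥(Subgroup.centralizer ({c} : Set ↥(unitaryGroupOfForm σ J)))) : ↥(unitaryGroupOfForm σ J)) : GL (Fin 3) K) : Matrix (Fin 3) (Fin 3) K) 0 0 - σ b * π' * ((((τ : ↥(Subgroup.centralizer ({c} : Set ↥(unitaryGroupOfForm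 σ J)))) : ↥(unitaryGroupOfForm σ J)) : GL (Fin 3) K) : Matrix (Fin 3) (Fin 3) K) 0 2) * (((((τ : ↥(Subgroup.centralizer ({c} : Set ↥(unitaryGroupOfForm σ J)))) : ↥(unitaryGroupOfForm σ J)) : GL (Fin 3) K) : Matrix (Fin 3) (Fin 3) K) 0 0 - σ b * π' * ((((τ : ↥(Subgroup.centralizer ({c} : Set ↥(unitaryGroupOfForm σ J)))) : ↥(unitaryGroupOfForm σ J)) : GL (Fin 3) K) : Matrix (Fin 3) (Fin 3) K) 0 2)) := by ring
      _ = 1 := by rw [h1, h3, one_mul]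
  -- surjectivity onto `E¹`: `x := ι u ∕ σ(ι u)`, `e := 1`, `y := 1` (★ F1 constructor)
  have hfs : ∀ u : Rˣ, ∃ τ : ↥(Subgroup.centralizer ({⟨t, htH⟩} : Set ↥(Subgroup.centralizer ({c} : Set ↥(unitaryGroupOfForm σ J))))), ((f τ : Kˣ) : K) = ι u / σ (ι u) := by
    intro u
    set μ : K := ι u / σ (ι u) with hμdef
    have hμ1 : μ * σ μ = 1 := TorusBridge.normOneMap_mul_map σ ι hι hσσ u
    have hμ1' : σ μ * μ = 1 := by rw [mul_comm]; exact hμ1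
    obtain ⟨τ₀, hτ₀⟩ := exists_coe_eq_traceTorusBlock σ hJ hσσ hb hππ hσπ hσπ' (x := μ) (e := 1) (y := 1) hμ1'
      (by rw [map_one, one_mul]) (by rw [map_one, one_mul])
    have hτ₀H : τ₀ ∈ (Subgroup.centralizer ({c} : Set ↥(unitaryGroupOfForm σ J))) := traceTorusBlock_mem_centralizer_diag σ hc hτ₀
    have hτ₀t : τ₀ ∈ Subgroup.centralizer ({t} : Set ↥(unitaryGroupOfForm σ J)) := traceTorusBlock_mem_centralizer σ hb hππ hte hτ₀
    have hτ₀T : (⟨τ₀, hτ₀H⟩ : ↥(Subgroup.centralizer ({c} : Set ↥(unitaryGroupOfForm σ J)))) ∈ (Subgroup.centralizer ({⟨t, htH⟩} : Set ↥(Subgroup.centralizer ({c} : Set ↥(unitaryGroupOfForm σ J))))) := by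
      rw [Subgroup.mem_centralizer_singleton_iff]
      exact Subtype.ext (Subgroup.mem_centralizer_singleton_iff.1 hτ₀t)
    refine ⟨⟨⟨τ₀, hτ₀H⟩, hτ₀T⟩, ?_⟩
    have eX : ((τ₀ : GL (Fin 3) K) : Matrix (Fin 3) (Fin 3) K) 0 0 + b * π' * ((τ₀ : GL (Fin 3) K) : Matrix (Fin 3) (Fin 3) K) 0 2 = μ := by
      rw [hτ₀]; simp only [Matrix.of_apply, Matrix.cons_val', Matrix.cons_val_zero, Matrix.cons_val_two, Matrix.empty_val', Matrix.cons_val_fin_one,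
        Matrix.tail_cons, Matrix.head_cons]
      linear_combination traceTorusBlock_read_fst σ hb hππ μ 1
    have eY : ((τ₀ : GL (Fin 3) K) : Matrix (Fin 3) (Fin 3) K) 0 0 - σ b * π' * ((τ₀ : GL (Fin 3) K) : Matrix (Fin 3) (Fin 3) K) 0 2 = 1 := by
      rw [hτ₀]; simp only [Matrix.of_apply, Matrix.cons_val', Matrix.cons_val_zero, Matrix.cons_val_two, Matrix.empty_val', Matrix.cons_val_fin_one,
        Matrix.tail_cons, Matrix.head_cons]
      linear_combination traceTorusBlock_read_snd σ hb hππ μ 1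
    rw [hfv]
    change (((τ₀ : GL (Fin 3) K) : Matrix (Fin 3) (Fin 3) K) 0 0 + b * π' * ((τ₀ : GL (Fin 3) K) : Matrix (Fin 3) (Fin 3) K) 0 2) *
        σ (((τ₀ : GL (Fin 3) K) : Matrix (Fin 3) (Fin 3) K) 0 0 - σ b * π' * ((τ₀ : GL (Fin 3) K) : Matrix (Fin 3) (Fin 3) K) 0 2) = μ
    rw [eX, eY, map_one, mul_one]
  -- (4) the subgroup `S = T ∩ r_i K_H r_i⁻¹` and its integrality criterion
  set S : Subgroup ↥(Subgroup.centralizer ({⟨t, htH⟩} : Set ↥(Subgroup.centralizer ({c} : Set ↥(unitaryGroupOfForm σ J))))) := (((flickerKH σ J c).subgroupOf (Subgroup.centralizer ({c} : Set ↥(unitaryGroupOfForm σ J)))).map (MulAut.conj (r i)).toMonoidHom).subgroupOf (Subgroup.centralizer ({⟨t, htH⟩} : Set ↥(Subgroup.centralizer ({c} : Set ↥(unitaryGroupOfForm σ J))))) with hSdef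
  have hϖi0 : ϖ ^ i ≠ 0 := pow_ne_zero _ hϖ0
  have hrinv : (((((r i)⁻¹ : ↥(Subgroup.centralizer ({c} : Set ↥(unitaryGroupOfForm σ J)))) : ↥(unitaryGroupOfForm σ J)) : GL (Fin 3) K) : Matrix (Fin 3) (Fin 3) K) =
      !![ϖ ^ i, 0, 0; 0, 1, 0; 0, 0, (ϖ ^ i)⁻¹] := by
    rw [Subgroup.coe_inv, Subgroup.coe_inv, Matrix.coe_units_inv, hr i]
    refine Matrix.inv_eq_left_inv ?_
    rw [block_mul_block]
    ext a d
    fin_cases a <;> fin_cases d <;> simp [hϖi0]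
  have hS : ∀ τ : ↥(Subgroup.centralizer ({⟨t, htH⟩} : Set ↥(Subgroup.centralizer ({c} : Set ↥(unitaryGroupOfForm σ J))))), τ ∈ S ↔ Valued.v (((f τ : Kˣ) : K) - 1) ≤ Valued.v (ι ϖR ^ (2 * i + ε)) := by
    intro τ
    obtain ⟨x, e, y, hM, hxr, hyr, her⟩ := hshape τ
    have hn1 := map_mul_self_eq_one_of_coe_eq_traceTorusBlock σ hJ hσσ hb hππ hσπ hσπ' hM
    obtain ⟨hvx, hve, hvy⟩ := v_traceTorusBlock_coord_eq_one σ hσv hn1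
    -- `|f τ − 1| = |x − y|` since `f τ − 1 = (x − y)·σy`
    have hfsub : Valued.v (((f τ : Kˣ) : K) - 1) = Valued.v (x - y) := by
      rw [hfv, ← hxr, ← hyr]
      have e1 : x * σ y - 1 = (x - y) * σ y := by linear_combination hn1.2.2
      rw [e1, map_mul, hσv, hvy, mul_one]
    -- the conjugate `(r i)⁻¹ τ (r i)` and its matrix
    have hconj : ((((((MulAut.conj (r i)).symm (τ : ↥(Subgroup.centralizer ({c} : Set ↥(unitaryGroupOfForm σ J))))) : ↥(Subgroup.centralizer ({c} : Set ↥(unitaryGroupOfForm σ J)))) : ↥(unitaryGroupOfForm σ J)) : GL (Fin 3) K) : Matrix (Fin 3) (Fin 3) K) =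
        !![x * σ b + y * b, 0, ϖ ^ i * (π * (x - y)) * ϖ ^ i; 0, e, 0; (ϖ ^ i)⁻¹ * (π' * (b * σ b * (x - y))) * (ϖ ^ i)⁻¹, 0, x * b + y * σ b] := by
      rw [MulAut.conj_symm_apply, Subgroup.coe_mul, Subgroup.coe_mul, Subgroup.coe_mul, Subgroup.coe_mul, Units.val_mul, Units.val_mul,
        hrinv, hr i]
      conv_lhs => rw [hM]
      rw [block_mul_block, block_mul_block]
      ext a d
      fin_cases a <;> fin_cases d <;> simp <;> field_simp
    have hpow : Valued.v (ϖ ^ (2 * i + ε)) = Valued.v π * (Valued.v (ϖ ^ i) * Valued.v (ϖ ^ i)) := by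
      rw [hπε, ← map_mul, ← map_mul]; congr 1; ring
    have hQ : Valued.v (π' * (b * σ b * (x - y))) = (Valued.v π)⁻¹ * Valued.v (x - y) := by
      rw [map_mul, map_mul, hvπ', hvbσb, one_mul]
    rw [hSdef, Subgroup.mem_subgroupOf, Subgroup.mem_map_equiv, Subgroup.mem_subgroupOf, mem_flickerKH_iff,
      mem_unitaryInt_iff_forall_v_apply_le_one σ hJ hσv, hconj,
      forall_v_radialConj_traceTorus_le_one_iff hϖ0 hvϖ1 hvx.le hvy.le hve.le hvb.le hvσb.le hvπ1, hfsub, hιϖ, hpow, hQ]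
    constructor
    · rintro ⟨-, hq'⟩
      calc Valued.v (x - y) = Valued.v π * ((Valued.v π)⁻¹ * Valued.v (x - y)) := by rw [mul_inv_cancel_left₀ hvπ0]
        _ ≤ Valued.v π * (Valued.v (ϖ ^ i) * Valued.v (ϖ ^ i)) := mul_le_mul_right hq' _
    · intro hle
      refine ⟨((MulAut.conj (r i)).symm (τ : ↥(Subgroup.centralizer ({c} : Set ↥(unitaryGroupOfForm σ J))))).2, ?_⟩
      calc (Valued.v π)⁻¹ * Valued.v (x - y)
          ≤ (Valued.v π)⁻¹ * (Valued.v π * (Valued.v (ϖ ^ i) * Valued.v (ϖ ^ i))) := mul_le_mul_right hle _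
        _ = Valued.v (ϖ ^ i) * Valued.v (ϖ ^ i) := by rw [inv_mul_cancel_left₀ hvπ0]
  -- (5) the index, via the 2-free weight transfer (★ (r-d)) and ★ (F3a)
  have key := TorusBridge.index_eq_index_units_of_normOne_of_isUnit_sub σ ι hι hιv σR hσι hσR hσv hgR hϖR f hf hfs S (2 * i + ε) hS
  change S.index = _
  rw [key]
  rcases Nat.eq_zero_or_pos (2 * i + ε) with h0 | hpos
  · rw [if_pos h0]
    obtain ⟨hi0, hε0⟩ : i = 0 ∧ ε = 0 := by omega
    subst hi0; subst hε0
    exact Literature.NumberTheory.LocalFields.UnramifiedQuadraticNorm.index_comap_eqLocus_zero σR hσR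
  · rw [if_neg (by omega), Literature.NumberTheory.LocalFields.UnramifiedQuadraticNorm.index_comap_eqLocus_eq σR hσR hgR hq hpos, mul_comm]

end Weight

end Literature.NumberTheory.Automorphic.UnitaryGroup
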